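import Literature.Computability.QuantumComplexity.SampleQueryAccess
import Literature.Computability.QuantumComplexity.SparseQSVTEstimation
import Literature.Analysis.ValidatedNumerics.ChebyshevInversePolynomial
import Literature.Barriers.QuantumAdvantage.QICLinearSystemsLowerBound
import HarnessLib
import HarnessLib.Audit.Tags

/-!
# Rung leaf F-Q4-L01 (cell qa-dq, D-0147): the sparse-SQ `κ`-threshold, UPPER HALF — STATEMENTS ONLY

This module is the RUNG LEAF F-Q4-L01 of cell qa-dq (HOME `run/shared/lean/pub/qa-dq/`, D-0147; D-0061
alt-closer pattern of `Summits/QuantumAdvantage/AdviceFreeQNC0/AdviceFreeQNC0.lean`). It declares the explicit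
objects and the target of line L-01 `sq-sparse-kappa-threshold` (seat qa-dq-idea-1; critic PASS qa-dq-crit-1
2026-08-27T23:06:34Z, grade new-combination; typed skeleton `HOME/lines/sq-sparse-kappa-threshold/line.lean`
sha16 8372500339bd4ff5, namespace `Scratch.QaDq.SqSparseKappaThreshold.Line`, six stubs + kernel-checked
`UpperHalf_of`) as named definitions and ASSERTS NOTHING: the closed leaf
`SparseQICUpperHalf : Prop := UpperHalf` is tagged `@[conjecture]` (an obligation node, provable / refutable BY
NAME, never a vendored fact); the route for line `sq-sparse-kappa-threshold` concludes it BY NAME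
(`closes : <stubs-as-items> → SparseQICUpperHalf`). Text = the definitions block and the target `UpperHalf` of
that line.lean VERBATIM (director-frontier ruling 2026-08-27T23:26:35Z: the leaf is `UpperHalf` ALONE).

WHAT `UpperHalf` SAYS (query-model dequantization, explicit constants, NO dependence on the dimension `n`): for
every row-sparsity `s`, condition bound `κ > 1` and accuracy `0 < ε ≤ 1/2`, with the explicit half-degree
`m = halfDeg κ ε = ⌈(κ/2)·log(2κ/ε)⌉`, the gapped Chebyshev inverse polynomial `p = gappedInv κ m` (degree
`2m − 1`; `Literature/Analysis/ValidatedNumerics/ChebyshevInversePolynomial.lean`), the ball budget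
`S = ballBudget s κ ε = Σ_{k<2m} s^k` and the entry bound `P = supBound κ ε = κ + ε`: for EVERY `n`, every
symmetric `M` with `s`-sparse rows (`IsSparse`), `‖M‖ ≤ 1`, `σ_min(M) ≥ 1/κ`, and `Mx = y ≠ 0`, the matrix
`B = p(M)` (i) inverts to accuracy `ε` (`‖By − x‖² ≤ ε²‖x‖²`, `‖By‖² ≥ (1−ε)²‖y‖²`), (ii) is supported on
radius-`(2m−1)` balls of the sparsity pattern, of size `≤ S`, with entries `≤ P`, (iii) one round of the
explicit rejection sampler (`proposal`, `acceptOut`; sample-and-query access to `y`,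
`Literature/Computability/QuantumComplexity/SampleQueryAccess.lean`) outputs index `i` with mass exactly
`𝒟_{By}(i)·‖By‖²/(S²P²‖y‖²)`, and (iv) any law dominating `(1−η)𝒟_{By}` is exactly `𝒟_{x̃'}` for some
`x̃'` with `‖x̃' − By‖² ≤ 2η‖By‖²`. Every quantity is a function of `(s, κ, ε)` alone. Explicit consequence
recorded in the cell's line card: `N_U(s, κ, ε) = (4S+3)⌈4S²P² ln(8/ε²)⌉` SQ accesses suffice, dimension-free.

CONDITIONAL INPUTS: none inside the Prop (all hypotheses are explicit binders). COMPANION (not part of this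
leaf): the LOWER half of the dichotomy is the tree's named fact
`Literature.Barriers.QuantumAdvantage.QIC.GronlundLarsen2025_qicLinearSystems_lowerBound` (Grønlund–Larsen
2025, Thm 1: pure-SQ algorithms need a number of accesses growing with `n` once `κ` is large); the conjunction
becomes a second leaf only when the access models are made commensurable (`QIC.SolvesOn`, p583876, plus a
model-A row-list alphabet) — until then the pairing is a juxtaposition across access models (critic S1).

Sources: Gharibian–Le Gall, STOC 2022 / SICOMP 2023 (arXiv:2111.09079) §4 (sparse-access polynomial
estimation, the `s^{2d}` pattern; tree `SparseQSVTEstimation.lean`); Shao–Montanaro, ACM TQC 2022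
(arXiv:2103.10309) §4 (SQ rejection sampling for sparse linear systems); Tang, STOC 2019 (arXiv:1807.04271)
§4 (length-square sampling access; tree `SampleQueryAccess.lean`); Demko–Moss–Smith, Math. Comp. 43 (1984)
491–499, doi:10.1090/s0025-5718-1984-0758197-9 (decay of the inverse of band matrices); Grønlund–Larsen 2025
(the lower half; tree `QICLinearSystemsLowerBound.lean`).

HONEST FRAMING / WHAT THIS IS NOT: a query-model statement about quantum-inspired CLASSICAL algorithms with
sparse / sample-and-query access; it does not bear on `BQP` versus `BPP` and nothing here proves or refutes
quantum advantage; no algorithm outside the stated access model is described.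
-/

namespace Summit.QuantumAdvantage.Dequantization

open Finset Matrix Polynomial
open Literature.Computability.QuantumComplexity
open Literature.Computability.QuantumComplexity.SampleQuery
open Literature.Computability.QuantumComplexity.SparseQuery
open Literature.Analysis.ValidatedNumerics

noncomputable section

/-! ### Explicit objects (verbatim from the typed line) -/

/-- Gapped Chebyshev inverse `p_{κ,m}(X) = (1 − 1/τ_m)·X·(chebInvPoly (1/κ²) 1 m)(X²)`:
`x·p(x) = 1 − q_m(x²)`, `q_m = chebResidual (1/κ²) 1 m`. Degree `2m − 1`. -/
def gappedInv (κ : ℝ) (m : ℕ) : ℝ[X] :=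
  C (1 - (chebTau (1 / κ ^ 2) 1 m)⁻¹) * X * (chebInvPoly (1 / κ ^ 2) 1 m).comp (X ^ 2)

/-- Half-degree `m(κ, ε) = ⌈(κ/2)·log(2κ/ε)⌉`. -/
def halfDeg (κ ε : ℝ) : ℕ := ⌈κ / 2 * Real.log (2 * κ / ε)⌉₊

/-- Entry bound `P(κ, ε) = κ + ε` (`= sup` of `|p|` over the GAPPED set `1/κ ≤ |x| ≤ 1`, which
contains `spec M`; the gap itself is never visited — crit-1 C7(v)). -/
def supBound (κ ε : ℝ) : ℝ := κ + ε

/-- Ball budget `S(s, κ, ε) = Σ_{k < 2m} s^k`. -/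
def ballBudget (s : ℕ) (κ ε : ℝ) : ℕ := ∑ k ∈ range (2 * halfDeg κ ε), s ^ k

/-- Walks of length `k` in the pattern of `M`. -/
def Reach {n : ℕ} (M : Matrix (Fin n) (Fin n) ℝ) : ℕ → Fin n → Fin n → Prop
  | 0, i, j => i = j
  | k + 1, i, j => ∃ l, M i l ≠ 0 ∧ Reach M k l j

open Classical in
/-- Radius-`D` ball of `i` in the pattern graph of `M`. -/
def ball {n : ℕ} (M : Matrix (Fin n) (Fin n) ℝ) (D : ℕ) (i : Fin n) : Finset (Fin n) :=
  univ.filter fun j => ∃ k ≤ D, Reach M k i j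

/-- Proposal mass on real index `i`: `j ∼ 𝒟_y`, then `i` uniform on a length-`S` padding of
`{i' : j ∈ N i'}`. -/
def proposal {n : ℕ} (S : ℕ) (N : Fin n → Finset (Fin n)) (y : Fin n → ℝ) (i : Fin n) : ℝ :=
  (∑ j ∈ N i, lengthSqDist y j) / S

/-- One round's accept-and-output-`i` mass. -/
def acceptOut {n : ℕ} (S : ℕ) (P : ℝ) (N : Fin n → Finset (Fin n)) (B : Matrix (Fin n) (Fin n) ℝ)
    (y : Fin n → ℝ) (i : Fin n) : ℝ :=
  proposal S N y i * ((B.mulVec y) i ^ 2 / ((S : ℝ) * P ^ 2 * ∑ j ∈ N i, y j ^ 2))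

/-! ### The target -/

/-- **(U) — the dimension-free half of the sparse-SQ κ-dichotomy, sampler-level.** For all `s`,
`κ > 1`, `0 < ε ≤ 1/2`, with `m = halfDeg κ ε`, `p = gappedInv κ m`, `S = ballBudget s κ ε`,
`P = supBound κ ε = κ + ε`, and for EVERY `n`, symmetric `M` with `s`-sparse rows/cols, `‖M‖ ≤ 1`,
`σ_min ≥ 1/κ`, `y ≠ 0`, `Mx = y`, writing `B = p(M)`, `N = ball M (2m−1)`:
(1) `‖By − x‖² ≤ ε²‖x‖²; (2) `‖By‖² ≥ (1−ε)²‖y‖²; (3) `supp Bᵢ ⊆ N i`, `|N i| ≤ S`, `N` symmetric,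
each index in `≤ S` balls, `|Bᵢⱼ| ≤ P`; (4) one rejection round: ratio `≤ 1`, proposal total `≤ 1`,
accept-and-output-`i` mass `= 𝒟_{By}(i)·‖By‖²/(S²P²‖y‖²)`; (5) any law `q ≥ (1−η)𝒟_{By}` is
EXACTLY `𝒟_{x̃'}` with `‖x̃' − By‖² ≤ 2η‖By‖²`. Every quantity is a function of `(s, κ, ε)`; no `n`. -/
def UpperHalf : Prop :=
  ∀ (s : ℕ) (κ ε : ℝ), 1 < κ → 0 < ε → ε ≤ 1 / 2 →
    ∀ (n : ℕ) (M : Matrix (Fin n) (Fin n) ℝ) (x y : Fin n → ℝ),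
      M.IsSymm → IsSparse s M → (∀ v, normSq (M.mulVec v) ≤ normSq v) →
      (∀ v, normSq v ≤ κ ^ 2 * normSq (M.mulVec v)) → y ≠ 0 → M.mulVec x = y →
      let m := halfDeg κ ε
      let B := aeval M (gappedInv κ m)
      let S := ballBudget s κ ε
      let P := supBound κ ε
      let N := ball M (2 * m - 1)
      (normSq (B.mulVec y - x) ≤ ε ^ 2 * normSq x) ∧
      ((1 - ε) ^ 2 * normSq y ≤ normSq (B.mulVec y)) ∧
      ((∀ i, rowSupport B i ⊆ N i) ∧ (∀ i, (N i).card ≤ S) ∧ (∀ i j, j ∈ N i ↔ i ∈ N j) ∧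
        (∀ j, (univ.filter fun i => j ∈ N i).card ≤ S) ∧ (∀ i j, |B i j| ≤ P)) ∧
      ((∀ i, (B.mulVec y) i ^ 2 ≤ (S : ℝ) * P ^ 2 * ∑ j ∈ N i, y j ^ 2) ∧
        (∑ i, proposal S N y i) ≤ 1 ∧
        (∀ i, acceptOut S P N B y i =
          lengthSqDist (B.mulVec y) i / ((S : ℝ) ^ 2 * P ^ 2 * normSq y / normSq (B.mulVec y)))) ∧
      (∀ (q : Fin n → ℝ) (η : ℝ), 0 ≤ η → η ≤ 1 → (∀ i, 0 ≤ q i) → ∑ i, q i = 1 →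
        (∀ i, (1 - η) * lengthSqDist (B.mulVec y) i ≤ q i) →
        ∃ xt' : Fin n → ℝ, lengthSqDist xt' = q ∧
          normSq (xt' - B.mulVec y) ≤ 2 * η * normSq (B.mulVec y))

/-! ### The closed leaf -/

/-- **Rung leaf F-Q4-L01** (cell qa-dq, line L-01 `sq-sparse-kappa-threshold`): the upper half of the
sparse-SQ `κ`-threshold, closed BY NAME by the line's route. An obligation node: asserts nothing. -/
@[conjecture] def SparseQICUpperHalf : Prop := UpperHalf

/-- Unfolding lemma: the leaf is literally `UpperHalf`. [bookkeeping] -/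
theorem sparseQICUpperHalf_iff : SparseQICUpperHalf ↔ UpperHalf := Iff.rfl

end

end Summit.QuantumAdvantage.Dequantization
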